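import Mathlib.NumberTheory.DirichletCharacter.Orthogonality
import Literature.NumberTheory.EllipticCurves.Otsuki2009.AdmissibleSystems
import HarnessLib

/-!
# Otsuki 2009, Lemma 3.7: an element of `R[G_M]` is determined by its character values (PROVED)

Topic `Literature/NumberTheory/EllipticCurves`, cluster `Otsuki2009` (namespace = path). Proofs
companion of `AdmissibleSystems` (Module A of the cell `bsd-wall` typer TURNKEY
`TURNKEY-TYPER-Otsuki2009-v1.md`: "Lemmas 3.7/3.8 (character values determine an admissible system)
— provable algebra; optional"). Theorems only, no named fact, 0 sorry.

Source: Rei Otsuki, *Construction of a homomorphism concerning Euler systems for an elliptic curve*,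
Tokyo J. Math. **32** (2009) 253–278 [Otsuki2009] (held copy `paper:doi-10-3836-tjm-1249648421`,
printed page = PDF page + 252), §3, proof of Thm. 3.6 (pp. 269–270): the identity `P_N(z_N) = θ_N`
is reduced to the equality of the character values `χ(P_N(z_N)) = χ(θ_N)` for all characters `χ`
of `G_N = (ℤ/N)ˣ` (Lemma 3.7: an element `η ∈ ℚ_p[G_N]` with `χ(η) = 0` for every character `χ`
of `G_N` is `0`; Lemma 3.8: an admissible system is determined by the values at the characters of
exact conductor, via the compatibilities). This file PROVES Lemma 3.7 in Module A's currency
`MonoidAlgebra R (ZMod M)ˣ`, for any integral domain `R` with enough roots of unity in which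
`φ(M) ≠ 0` (e.g. `ℚ̄_p`, `ℂ`, or `ℚ_p(μ_{φ(M)})`), from Mathlib's orthogonality relation
`DirichletCharacter.sum_char_inv_mul_char_eq`; Lemma 3.8 (induction over the divisors of `N` with
`IsAdmissibleSystem`) is left to the Module B typer.

## Contents

* `charValue χ : MonoidAlgebra R (ZMod M)ˣ →ₐ[R] R` — «`χ(η) = Σ_σ η(σ) χ(σ)`», the `R`-algebra
  homomorphism `MonoidAlgebra.lift` of `χ|_{(ℤ/M)ˣ}`; `charValue_single`, `charValue_apply`.
* `charValue_levelRestrict` — `χ(π_{M/L} η) = (χ ↑ M)(η)` for `L ∣ M` (`DirichletCharacter.changeLevel`):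
  the restriction map of Module A is dual to the change of level of characters.
* `sum_charValue_mul_inv` — `Σ_χ χ(b⁻¹) χ(η) = φ(M) · η(b)` (Fourier inversion on `G_M`).
* `eq_zero_of_forall_charValue_eq_zero` (Lemma 3.7), `eq_of_forall_charValue_eq`,
  `charValue_injective`-style corollary `ext_charValue`.

## References

* [Otsuki2009] §3, Lemma 3.7 and Lemma 3.8 (pp. 269–270), proof of Thm. 3.6.
* Mathlib `Mathlib.NumberTheory.DirichletCharacter.Orthogonality` (M. Stoll).
-/

noncomputable section

open scoped Classical

namespace Literature.NumberTheory.EllipticCurves.Otsuki2009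

variable {R : Type*} [CommRing R]

/-! ## The character value `χ(η)` -/

/-- **`χ(η) = Σ_{σ ∈ G_M} η(σ) χ(σ)`**: the value of `η ∈ R[G_M]`, `G_M = (ℤ/M)ˣ`, at a character
`χ` of `G_M` (a Dirichlet character mod `M` with values in `R`), as the `R`-algebra homomorphism
`R[G_M] → R` extending `χ|_{G_M}` (Mathlib `MonoidAlgebra.lift`). This is the `χ(·)` of Otsuki's
Lemmas 3.7/3.8 and of `χ(θ_N) = τ(χ) L(E, χ⁻¹, 1)/Ω^±` (p. 266).
[cite: Otsuki2009, §3 (p. 266) and Lemma 3.7 (p. 269)] -/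
def charValue {M : ℕ} (χ : DirichletCharacter R M) : MonoidAlgebra R (ZMod M)ˣ →ₐ[R] R :=
  MonoidAlgebra.lift R R (ZMod M)ˣ ((Units.coeHom R).comp χ.toUnitHom)

/-- `χ(r·σ) = r χ(σ)` on a group element. [cite: Otsuki2009, §3 (p. 266)] -/
@[simp] theorem charValue_single {M : ℕ} (χ : DirichletCharacter R M) (σ : (ZMod M)ˣ) (r : R) :
    charValue χ (MonoidAlgebra.single σ r) = r * χ σ := by
  rw [charValue, MonoidAlgebra.lift_single, smul_eq_mul, MonoidHom.comp_apply, Units.coeHom_apply,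
    MulChar.coe_toUnitHom]

/-- `χ(η) = Σ_σ η(σ) χ(σ)` (sum over the support). [cite: Otsuki2009, §3 (p. 266)] -/
theorem charValue_apply {M : ℕ} (χ : DirichletCharacter R M) (η : MonoidAlgebra R (ZMod M)ˣ) :
    charValue χ η = η.coeff.sum fun σ r ↦ r * χ σ := by
  simp only [charValue, MonoidAlgebra.lift_apply, smul_eq_mul, MonoidHom.comp_apply,
    Units.coeHom_apply, MulChar.coe_toUnitHom]

/-- **Restriction of levels is dual to change of level of characters**: for `L ∣ M`, a character
`χ` mod `L` and `η ∈ R[G_M]`, `χ(π_{M/L} η) = (χ∘π)(η)` where `χ∘π = DirichletCharacter.changeLevel`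
(`π_{M/L} = levelRestrict`, Module A). [cite: Otsuki2009, §3 (p. 266, the map π_{M/L})] -/
theorem charValue_levelRestrict {L M : ℕ} (h : L ∣ M) (χ : DirichletCharacter R L)
    (η : MonoidAlgebra R (ZMod M)ˣ) :
    charValue χ (levelRestrict R h η) = charValue (DirichletCharacter.changeLevel h χ) η := by
  conv_lhs => rw [← MonoidAlgebra.sum_coeff_single η]
  conv_rhs => rw [← MonoidAlgebra.sum_coeff_single η]
  rw [map_finsuppSum, map_finsuppSum, map_finsuppSum]
  refine Finsupp.sum_congr fun σ _ ↦ ?_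
  rw [levelRestrict_single, charValue_single, charValue_single]
  congr 1
  rw [DirichletCharacter.changeLevel_def, MulChar.ofUnitHom_coe, MonoidHom.comp_apply,
    MulChar.coe_toUnitHom]

/-! ## Lemma 3.7: Fourier inversion on `G_M` and the injectivity of `η ↦ (χ(η))_χ` -/

section Orthogonality

variable [IsDomain R] {M : ℕ} [NeZero M] [HasEnoughRootsOfUnity R (Monoid.exponent (ZMod M)ˣ)]

/-- **Fourier inversion on `G_M`**: `Σ_χ χ(b)⁻¹ · χ(η) = φ(M) · η(b)` for `b ∈ G_M`, the sum over all
Dirichlet characters mod `M` with values in `R` (`R` a domain with enough roots of unity; Mathlib's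
orthogonality `sum_char_inv_mul_char_eq`). [cite: Otsuki2009, Lemma 3.7 (p. 269, proof)] -/
theorem sum_charValue_mul_inv (η : MonoidAlgebra R (ZMod M)ˣ) (b : (ZMod M)ˣ) :
    ∑ χ : DirichletCharacter R M, χ ((b⁻¹ : (ZMod M)ˣ) : ZMod M) * charValue χ η =
      (M.totient : R) * η.coeff b := by
  simp_rw [charValue_apply, Finsupp.mul_sum, Finsupp.sum]
  rw [Finset.sum_comm]
  simp_rw [mul_left_comm _ (η.coeff _) _, ← Finset.mul_sum, ← ZMod.inv_coe_unit,
    DirichletCharacter.sum_char_inv_mul_char_eq R (Units.isUnit b)]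
  simp_rw [Units.val_injective.eq_iff, mul_ite, mul_zero]
  rw [Finset.sum_ite_eq η.coeff.support b]
  split_ifs with hb
  · exact mul_comm _ _
  · rw [Finsupp.notMem_support_iff.mp hb, mul_zero]

/-- **Otsuki 2009, Lemma 3.7 (PROVED): an element of `R[G_M]` all of whose character values vanish
is zero** — for `R` an integral domain with enough roots of unity in which `φ(M) ≠ 0` (e.g. any
domain of characteristic `0` containing `μ_{φ(M)}`: `ℚ̄_p`, `ℂ`). "If `χ(η) = 0` for all characters
`χ` of `G_N`, then `η = 0`." [cite: Otsuki2009, Lemma 3.7 (p. 269)] -/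
theorem eq_zero_of_forall_charValue_eq_zero (hM : (M.totient : R) ≠ 0)
    (η : MonoidAlgebra R (ZMod M)ˣ) (h : ∀ χ : DirichletCharacter R M, charValue χ η = 0) :
    η = 0 := by
  refine MonoidAlgebra.ext (Finsupp.ext fun b ↦ ?_)
  have hsum := sum_charValue_mul_inv η b
  simp only [h, mul_zero, Finset.sum_const_zero] at hsum
  rw [MonoidAlgebra.coeff_zero, Finsupp.coe_zero, Pi.zero_apply]
  exact (mul_eq_zero.mp hsum.symm).resolve_left hM

/-- **Lemma 3.7, equality form**: two elements of `R[G_M]` with the same character values are equal.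
[cite: Otsuki2009, Lemma 3.7 (p. 269)] -/
theorem eq_of_forall_charValue_eq (hM : (M.totient : R) ≠ 0) {η η' : MonoidAlgebra R (ZMod M)ˣ}
    (h : ∀ χ : DirichletCharacter R M, charValue χ η = charValue χ η') : η = η' := by
  rw [← sub_eq_zero]
  exact eq_zero_of_forall_charValue_eq_zero hM _ fun χ ↦ by rw [map_sub, h χ, sub_self]

/-- **Lemma 3.7 in characteristic zero** (the case of the source, `R ⊇ ℚ_p`): no hypothesis on
`φ(M)`. [cite: Otsuki2009, Lemma 3.7 (p. 269)] -/
theorem eq_of_forall_charValue_eq' [CharZero R] {η η' : MonoidAlgebra R (ZMod M)ˣ}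
    (h : ∀ χ : DirichletCharacter R M, charValue χ η = charValue χ η') : η = η' :=
  eq_of_forall_charValue_eq (by exact_mod_cast (Nat.totient_pos.mpr (NeZero.pos M)).ne') h

end Orthogonality

end Literature.NumberTheory.EllipticCurves.Otsuki2009

end
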